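import Mathlib
import Summits.CriticalPhenomena.PercolationContinuityZ3.Theorems.PercNearOneGluingNoHeavyLowerTailSigmaCM
import HarnessLib

/-!
# CONJECTURE A′ (the W♯ odds of the pure-grabber are discrete Bernstein) for `γ ≥ 1 - θ₀` — TP_∞ of THEOREM N's class for every `q_A`

Support file for the Sahi / Conjecture-P programme of route `PercNearOneGluingNoHeavy`
(`--supports stmt-CriticalPhenomena-4575`, prover prim-l12-p5 gen 37; proof note
`prim-l12-p5/PROOF-ODDS-BERNSTEIN-g37.md`).  No definitions, no named facts, no sorries.

Setting (PROOF-THEOREM-H-g36 §6′).  `θ > 0` real, `γ = s + 1 > 0`, `0 ≤ g < 1`, `h = 1 - g`,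
`P(m) = ₂F₁(-θ,-m;γ+1;g)`, `Q_ϑ(m) = ₂F₁(-ϑ,-m;γ;g)` (finite sums, the hypothesis-definition `H` of
`…LowerTailHypergeomSums`).  The W♯ odds of the pure-grabber `c̃_m = γ Q_θ(m)/P(m-1)` are
`a_m = m/c̃_m = m P(m-1)/(γ Q_θ(m))`; CONJECTURE A′ (g36, numerical) says that `a` is discrete Bernstein
(`a ≥ 0`, `Δa` completely monotone) iff `θ + γ ≥ 1`, and by the SCALING LEMMA (`lPlusC_div_factorial_tn_of_odds`)
this makes `[(l + λ c̃_n)/(n-l)!]` totally nonnegative for EVERY `λ > 0`, i.e. (THEOREM W♯ + PROOF-TWO-RAY (0.5))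
`F_s` is TP_∞ for `Ψ = (1+p_A u+q_A v)(1+p_B u+q_B v)^θ` with no condition on `q_A` (g36 had `q_A ≥ 1`).

This file proves:

* `hyp_ab` — the contiguous identity `(r+1)(Q_θ(r+1) - Q_θ(r)) = θ (Q_θ(r+1) - Q_{θ-1}(r+1))`
  (DLMF 15.5.12-type, `(a-b)F = aF(a+) - bF(b+)` at `b = -r-1`), termwise;
* `pureGrabber_key` / `pureGrabber_odds_eq` — the IDENTITY behind everything (memo §1):
  `g(γ+θ) a_m = g(m-θ) + θ(1 - h·Q_{θ-1}(m)/Q_θ(m))`, hence `Δa_m = [g + θh(ρ_m - ρ_{m+1})]/(g(γ+θ))` with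
  `ρ_m = Q_{θ-1}(m)/Q_θ(m)`: **A′ holds as soon as `ρ` is completely monotone** (`oddsDiff_altSum_nonneg_of_ratio`;
  the converse holds too, memo §1, since `ρ_m → 0`);
* `hyp_inv_altSum_aux'` — THEOREM H's induction (g36 `hyp_inv_altSum_aux`) run at level `c = γ` under the SHARP base
  hypothesis `1 - θ₀ ≤ c` (instead of `1 ≤ c`), `θ = θ₀ + n`, `θ₀ ∈ (0,1]`: `1/Q_θ` and `ρ = Q_{θ-1}/Q_θ` are CM;
* `pureGrabber_oddsDiff_altSum_nonneg` — **THEOREM A′ (Region I)**: for `θ = θ₀ + n` (`0 < θ₀ ≤ 1`, `n ∈ ℕ`),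
  `γ > 0`, `γ ≥ 1 - θ₀`, `0 ≤ g < 1`, the odds `a` have completely monotone first difference;
* `lPlusC_div_factorial_tn_pureGrabber` — consequently `[(l + λ c̃_n)/(n-l)!]_{l ≤ n}` is totally nonnegative for every
  `λ > 0` (THEOREM N TP_∞ in matrix form for all `q_A`, whenever `s ≥ -θ₀`; in particular for all `s ≥ 0`, and for
  all `s > -1` when `θ ∈ ℕ`), and `lPlusC_div_factorial_tn_pureGrabber'` — the same for every `θ > 0` when `γ ≥ 1`.
-/

namespace Summit.CriticalPhenomena.PercolationContinuityZ3.Theorems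

namespace HypergeomCM

open Finset MomentRatioTN
open scoped Nat

section

variable (g : ℝ) (H : ℝ → ℝ → ℕ → ℝ)
  (hH : ∀ a c r, H a c r = ∑ k ∈ range (r + 1), (r.choose k : ℝ) * (-g) ^ k *
    ((∏ i ∈ range k, (a + i)) / (∏ i ∈ range k, (c + i))))
include hH

/-- At `g = 0` every `H a c r` equals `1`. -/
theorem hyp_g_zero (hg : g = 0) (a c : ℝ) (r : ℕ) : H a c r = 1 := by
  rw [hH, sum_range_succ', hg]
  simp

/-- **Contiguous identity (AB)**: `(r+1)·(H a c (r+1) - H a c r) = -a·(H a c (r+1) - H (a+1) c (r+1))`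
(termwise: `(r+1)(C(r+1,k) - C(r,k)) = k C(r+1,k)` and `-a((a)_k - (a+1)_k) = k (a)_k`).  At `a = -θ` this is
`(r+1) ΔQ_θ(r) = θ (Q_θ(r+1) - Q_{θ-1}(r+1))`. -/
theorem hyp_ab (a c : ℝ) (r : ℕ) :
    ((r : ℝ) + 1) * (H a c (r + 1) - H a c r) = -a * (H a c (r + 1) - H (a + 1) c (r + 1)) := by
  have hr : H a c r = ∑ k ∈ range (r + 1 + 1), (r.choose k : ℝ) * (-g) ^ k *
      ((∏ i ∈ range k, (a + i)) / (∏ i ∈ range k, (c + i))) := by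
    rw [hH a c r, sum_range_succ _ (r + 1), Nat.choose_eq_zero_of_lt (Nat.lt_succ_self r)]
    simp
  rw [hH a c (r + 1), hr, hH (a + 1) c (r + 1), ← sum_sub_distrib, ← sum_sub_distrib, mul_sum, mul_sum]
  refine sum_congr rfl fun k _ => ?_
  -- (i) binomial identity
  have e1 : ((r : ℝ) + 1) * (((r + 1).choose k : ℝ) - (r.choose k : ℝ)) = (k : ℝ) * ((r + 1).choose k : ℝ) := by
    rcases k with _ | k
    · simp
    · have h1 : (r + 1).choose (k + 1) = r.choose k + r.choose (k + 1) := Nat.choose_succ_succ' r k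
      have h2 : (r + 1) * r.choose k = (r + 1).choose (k + 1) * (k + 1) := Nat.add_one_mul_choose_eq r k
      have h1' : (((r + 1).choose (k + 1) : ℕ) : ℝ) = (r.choose k : ℝ) + (r.choose (k + 1) : ℝ) := by
        exact_mod_cast h1
      have h2' : ((r : ℝ) + 1) * (r.choose k : ℝ) = (((r + 1).choose (k + 1) : ℕ) : ℝ) * ((k : ℝ) + 1) := by
        exact_mod_cast h2
      push_cast
      linear_combination ((r : ℝ) + 1) * h1' + h2'
  -- (ii) Pochhammer identity: a · ∏_{i<k}(a+1+i) = (∏_{i<k}(a+i)) · (a+k)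
  have e2 : a * ∏ i ∈ range k, (a + 1 + (i : ℝ)) = (∏ i ∈ range k, (a + (i : ℝ))) * (a + k) := by
    rw [← prod_succ_shift a k, prod_range_succ]
  rw [div_eq_mul_inv, div_eq_mul_inv]
  linear_combination ((-g) ^ k * (∏ i ∈ range k, (a + (i : ℝ))) * (∏ i ∈ range k, (c + (i : ℝ)))⁻¹) * e1 -
    (((r + 1).choose k : ℝ) * (-g) ^ k * (∏ i ∈ range k, (c + (i : ℝ)))⁻¹) * e2

/-- **The key identity** (memo §1, multiplied out): for `γ > 0` and every `r`,
`g(γ+θ)(r+1)·P(r) = γ·(g(r+1) + (1-g)θ)·Q_θ(r+1) - γ(1-g)θ·Q_{θ-1}(r+1)`,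
where `P = H(-θ)(γ+1)`, `Q_θ = H(-θ)γ`, `Q_{θ-1} = H(1-θ)γ`.  (positive recurrence + (AB).) -/
theorem pureGrabber_key (θ γ : ℝ) (hγ : 0 < γ) (r : ℕ) :
    g * (γ + θ) * ((r : ℝ) + 1) * H (-θ) (γ + 1) r =
      γ * (g * ((r : ℝ) + 1) + (1 - g) * θ) * H (-θ) γ (r + 1) - γ * (1 - g) * θ * H (1 - θ) γ (r + 1) := by
  have h1 := hyp_posrec g H hH (-θ) γ hγ r
  have h2 := hyp_ab g H hH (-θ) γ r
  rw [show -θ + 1 = 1 - θ by ring] at h2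
  linear_combination -((r : ℝ) + 1) * h1 + γ * (1 - g) * h2

/-- **The key identity, odds form**: with `a_m := m P(m-1)/(γ Q_θ(m))` (so `a_0 = 0`) and
`ρ_m := Q_{θ-1}(m)/Q_θ(m)`, for every `m`: `g(γ+θ) a_m = g(m - θ) + θ(1 - (1-g) ρ_m)`. -/
theorem pureGrabber_odds_eq (θ γ : ℝ) (hγ : 0 < γ) (hQ : ∀ m, 0 < H (-θ) γ m) (m : ℕ) :
    g * (γ + θ) * ((m : ℝ) * H (-θ) (γ + 1) (m - 1) / (γ * H (-θ) γ m)) =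
      g * ((m : ℝ) - θ) + θ * (1 - (1 - g) * (H (1 - θ) γ m / H (-θ) γ m)) := by
  rcases m with _ | r
  · rw [hyp_zero g H hH (1 - θ) γ, hyp_zero g H hH (-θ) γ]
    simp only [Nat.cast_zero, zero_mul, zero_div, mul_zero, zero_sub, div_one, mul_one]
    ring
  · have key := pureGrabber_key g H hH θ γ hγ r
    have hQ0 := (hQ (r + 1)).ne'
    have hγ0 := hγ.ne'
    rw [Nat.add_sub_cancel]
    push_cast
    field_simp
    linear_combination key

/-- **A′ from the ratio**: if `γ > 0`, `θ ≥ 0`, `0 ≤ g < 1`, `Q_θ > 0` and `ρ = Q_{θ-1}/Q_θ` is completely monotone,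
then the odds `a_m = m P(m-1)/(γ Q_θ(m))` have completely monotone first difference
(`Δa_m = [g + θ(1-g)(ρ_m - ρ_{m+1})]/(g(γ+θ))` for `g > 0`; `a_m = m/γ` for `g = 0`). -/
theorem oddsDiff_altSum_nonneg_of_ratio (hg0 : 0 ≤ g) (hg1 : g < 1) (θ γ : ℝ) (hθ : 0 ≤ θ) (hγ : 0 < γ)
    (hQ : ∀ m, 0 < H (-θ) γ m)
    (hρ : ∀ k j, 0 ≤ ∑ i ∈ range (k + 1), (-1 : ℝ) ^ i * (k.choose i : ℝ) *
      (H (1 - θ) γ (j + i) / H (-θ) γ (j + i)))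
    (k j : ℕ) : 0 ≤ ∑ i ∈ range (k + 1), (-1 : ℝ) ^ i * (k.choose i : ℝ) *
      ((((j + i + 1 : ℕ) : ℝ)) * H (-θ) (γ + 1) (j + i + 1 - 1) / (γ * H (-θ) γ (j + i + 1)) -
        (((j + i : ℕ) : ℝ)) * H (-θ) (γ + 1) (j + i - 1) / (γ * H (-θ) γ (j + i))) := by
  rcases eq_or_lt_of_le hg0 with hg | hg
  · -- g = 0: a_m = m/γ, Δa = 1/γ
    have e : ∀ m : ℕ, (((m + 1 : ℕ) : ℝ)) * H (-θ) (γ + 1) (m + 1 - 1) / (γ * H (-θ) γ (m + 1)) -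
        ((m : ℕ) : ℝ) * H (-θ) (γ + 1) (m - 1) / (γ * H (-θ) γ m) = γ⁻¹ * (1 : ℝ) ^ m := by
      intro m
      rw [hyp_g_zero g H hH hg.symm, hyp_g_zero g H hH hg.symm, hyp_g_zero g H hH hg.symm,
        hyp_g_zero g H hH hg.symm]
      have := hγ.ne'
      push_cast
      field_simp
      ring
    simp_rw [e]
    rw [altSum_const_mul, altSum_geom]
    have : (0 : ℝ) ≤ (1 - 1) ^ k := pow_nonneg (by norm_num) k
    have : 0 ≤ γ⁻¹ := inv_nonneg.2 hγ.le
    positivity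
  · -- g > 0: Δa_m = [g + θ h (ρ_m - ρ_{m+1})]/(g(γ+θ))
    have hgθ : 0 < g * (γ + θ) := mul_pos hg (by linarith)
    have e : ∀ m : ℕ, (((m + 1 : ℕ) : ℝ)) * H (-θ) (γ + 1) (m + 1 - 1) / (γ * H (-θ) γ (m + 1)) -
        ((m : ℕ) : ℝ) * H (-θ) (γ + 1) (m - 1) / (γ * H (-θ) γ m) =
        (g * (γ + θ))⁻¹ * g + (g * (γ + θ))⁻¹ * (θ * (1 - g)) *
          (H (1 - θ) γ m / H (-θ) γ m - H (1 - θ) γ (m + 1) / H (-θ) γ (m + 1)) := by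
      intro m
      have h1 := pureGrabber_odds_eq g H hH θ γ hγ hQ (m + 1)
      have h0 := pureGrabber_odds_eq g H hH θ γ hγ hQ m
      have hne := hgθ.ne'
      -- X1 - X0 where g(γ+θ) X = ...
      have hX1 : (((m + 1 : ℕ) : ℝ)) * H (-θ) (γ + 1) (m + 1 - 1) / (γ * H (-θ) γ (m + 1)) =
          (g * (γ + θ))⁻¹ * (g * ((((m + 1 : ℕ) : ℝ)) - θ) +
            θ * (1 - (1 - g) * (H (1 - θ) γ (m + 1) / H (-θ) γ (m + 1)))) := by
        rw [← h1]; field_simp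
      have hX0 : ((m : ℕ) : ℝ) * H (-θ) (γ + 1) (m - 1) / (γ * H (-θ) γ m) =
          (g * (γ + θ))⁻¹ * (g * (((m : ℕ) : ℝ) - θ) + θ * (1 - (1 - g) * (H (1 - θ) γ m / H (-θ) γ m))) := by
        rw [← h0]; field_simp
      rw [hX1, hX0]
      push_cast
      ring
    simp_rw [e]
    rw [altSum_const_add_mul ((g * (γ + θ))⁻¹ * g) ((g * (γ + θ))⁻¹ * (θ * (1 - g)))
      (fun m => H (1 - θ) γ m / H (-θ) γ m - H (1 - θ) γ (m + 1) / H (-θ) γ (m + 1)) k j]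
    have hD : ∑ i ∈ range (k + 1), (-1 : ℝ) ^ i * (k.choose i : ℝ) *
        (H (1 - θ) γ (j + i) / H (-θ) γ (j + i) - H (1 - θ) γ (j + i + 1) / H (-θ) γ (j + i + 1)) =
        ∑ i ∈ range (k + 2), (-1 : ℝ) ^ i * ((k + 1).choose i : ℝ) * (H (1 - θ) γ (j + i) / H (-θ) γ (j + i)) :=
      (altSum_succ (fun m => H (1 - θ) γ m / H (-θ) γ m) k j).symm
    rw [hD]
    have h1 : (0 : ℝ) ≤ (1 - 1) ^ k := pow_nonneg (by norm_num) k
    have h2 : 0 ≤ (g * (γ + θ))⁻¹ := inv_nonneg.2 hgθ.le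
    have h3 : 0 ≤ θ * (1 - g) := mul_nonneg hθ (by linarith)
    have h4 := hρ (k + 1) j
    positivity

/-- THEOREM H's induction at a general level `c > 0` under the sharp base hypothesis `1 - θ₀ ≤ c`
(g36 `hyp_inv_altSum_aux` had `1 ≤ c`): for `θ₀ ∈ (0,1]`, `θ₀ + c ≥ 1` and every `n`, both `1/Q_{θ₀+n}` and
`Q_{θ₀+n-1}/Q_{θ₀+n}` are completely monotone (`Q_ϑ = H(-ϑ) c`).  The proof is g36's, verbatim, with the base case
`Q_{θ₀-1} = H(1-θ₀) c` CM now justified by `1 - θ₀ ≤ c`. -/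
theorem hyp_inv_altSum_aux' (hg0 : 0 ≤ g) (hg1 : g < 1) (c : ℝ) (hc0 : 0 < c) (θ₀ : ℝ) (h0 : 0 < θ₀)
    (h1 : θ₀ ≤ 1) (hc1 : 1 - θ₀ ≤ c) : ∀ n : ℕ,
      (∀ k j, 0 ≤ ∑ i ∈ range (k + 1), (-1 : ℝ) ^ i * (k.choose i : ℝ) * (H (-(θ₀ + n)) c (j + i))⁻¹) ∧
      (∀ k j, 0 ≤ ∑ i ∈ range (k + 1), (-1 : ℝ) ^ i * (k.choose i : ℝ) *
        (H (1 - (θ₀ + n)) c (j + i) * (H (-(θ₀ + n)) c (j + i))⁻¹)) := by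
  have hPpos : ∀ ϑ : ℝ, 0 ≤ ϑ → ∀ r, 0 < H (-ϑ) c r :=
    fun ϑ hϑ r => hyp_pos g H hH hg0 hg1 (-ϑ) r c hc0 (by linarith)
  intro n
  induction n with
  | zero =>
    simp only [Nat.cast_zero, add_zero]
    have hΔ : ∀ r, H (-θ₀) c (r + 1) - H (-θ₀) c r = θ₀ * g / c * H (1 - θ₀) (c + 1) r := by
      intro r
      have hs := hyp_step g H hH (-θ₀) c hc0 r
      rw [show -θ₀ + 1 = 1 - θ₀ by ring] at hs
      field_simp
      linear_combination hs
    have hinv : ∀ k j, 0 ≤ ∑ i ∈ range (k + 1), (-1 : ℝ) ^ i * (k.choose i : ℝ) *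
        (H (-θ₀) c (j + i))⁻¹ := by
      refine altSum_inv_nonneg (fun r => H (-θ₀) c r) (hPpos θ₀ h0.le) fun k j => ?_
      simp_rw [hΔ]
      rw [altSum_const_mul]
      exact mul_nonneg (div_nonneg (mul_nonneg h0.le hg0) hc0.le)
        (hyp_altSum_nonneg g H hH hg0 hg1 (1 - θ₀) (c + 1) (by linarith) (by linarith) (by linarith) k j)
    refine ⟨hinv, fun k j => ?_⟩
    exact altSum_mul_nonneg (fun r => H (1 - θ₀) c r) (fun r => (H (-θ₀) c r)⁻¹)
      (hyp_altSum_nonneg g H hH hg0 hg1 (1 - θ₀) c (by linarith) hc1 hc0) hinv k j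
  | succ n ih =>
    obtain ⟨ihA, ihB⟩ := ih
    have e1 : -(θ₀ + ((n + 1 : ℕ) : ℝ)) = -(θ₀ + n) - 1 := by push_cast; ring
    have e2 : (1 : ℝ) - (θ₀ + ((n + 1 : ℕ) : ℝ)) = -(θ₀ + n) := by push_cast; ring
    simp only [e1, e2]
    set ϑ : ℝ := θ₀ + (n : ℝ) with hϑdef
    have hϑ0 : 0 < ϑ := by rw [hϑdef]; positivity
    have hcϑ : 0 < c + ϑ := by linarith
    have hP0 : ∀ r, 0 < H (-ϑ) c r := hPpos ϑ hϑ0.le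
    have hP1 : ∀ r, 0 < H (-ϑ - 1) c r := fun r => by
      have := hPpos (ϑ + 1) (by linarith) r
      rwa [show -(ϑ + 1) = -ϑ - 1 by ring] at this
    have hR : ∀ r : ℕ, H (-ϑ - 1) c r * (H (-ϑ) c r)⁻¹ =
        ((2 * ϑ + c + ((r : ℝ) - ϑ) * g) - ϑ * (1 - g) * (H (1 - ϑ) c r * (H (-ϑ) c r)⁻¹)) / (c + ϑ) := by
      intro r
      have hg' := hyp_gauss g H hH r (-ϑ) c hc0
      rw [show -ϑ + 1 = 1 - ϑ by ring] at hg'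
      have h0 := (hP0 r).ne'
      have hcϑ' := hcϑ.ne'
      field_simp
      linear_combination hg'
    have hΔR : ∀ r : ℕ, H (-ϑ - 1) c (r + 1) * (H (-ϑ) c (r + 1))⁻¹ - H (-ϑ - 1) c r * (H (-ϑ) c r)⁻¹ =
        g / (c + ϑ) + ϑ * (1 - g) / (c + ϑ) *
          (H (1 - ϑ) c r * (H (-ϑ) c r)⁻¹ - H (1 - ϑ) c (r + 1) * (H (-ϑ) c (r + 1))⁻¹) := by
      intro r
      rw [hR (r + 1), hR r]
      have hcϑ' := hcϑ.ne'
      push_cast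
      field_simp
      ring
    have hΔR_cm : ∀ k j, 0 ≤ ∑ i ∈ range (k + 1), (-1 : ℝ) ^ i * (k.choose i : ℝ) *
        (H (-ϑ - 1) c (j + i + 1) * (H (-ϑ) c (j + i + 1))⁻¹ - H (-ϑ - 1) c (j + i) * (H (-ϑ) c (j + i))⁻¹) := by
      intro k j
      simp_rw [hΔR]
      rw [altSum_const_add_mul (g / (c + ϑ)) (ϑ * (1 - g) / (c + ϑ))
        (fun r => H (1 - ϑ) c r * (H (-ϑ) c r)⁻¹ - H (1 - ϑ) c (r + 1) * (H (-ϑ) c (r + 1))⁻¹) k j]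
      have hk : ∑ i ∈ range (k + 1), (-1 : ℝ) ^ i * (k.choose i : ℝ) *
          (H (1 - ϑ) c (j + i) * (H (-ϑ) c (j + i))⁻¹ - H (1 - ϑ) c (j + i + 1) * (H (-ϑ) c (j + i + 1))⁻¹) =
          ∑ i ∈ range (k + 2), (-1 : ℝ) ^ i * ((k + 1).choose i : ℝ) *
            (H (1 - ϑ) c (j + i) * (H (-ϑ) c (j + i))⁻¹) :=
        (altSum_succ (fun r => H (1 - ϑ) c r * (H (-ϑ) c r)⁻¹) k j).symm
      rw [hk]
      have hB := ihB (k + 1) j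
      have : (0 : ℝ) ≤ (1 - 1) ^ k := pow_nonneg (by norm_num) k
      have hA : 0 ≤ g / (c + ϑ) := div_nonneg hg0 hcϑ.le
      have hB0 : 0 ≤ ϑ * (1 - g) / (c + ϑ) := div_nonneg (mul_nonneg hϑ0.le (by linarith)) hcϑ.le
      positivity
    have hRinv : ∀ k j, 0 ≤ ∑ i ∈ range (k + 1), (-1 : ℝ) ^ i * (k.choose i : ℝ) *
        (H (-ϑ) c (j + i) * (H (-ϑ - 1) c (j + i))⁻¹) := by
      intro k j
      have := altSum_inv_nonneg (fun r => H (-ϑ - 1) c r * (H (-ϑ) c r)⁻¹)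
        (fun r => mul_pos (hP1 r) (inv_pos.2 (hP0 r))) hΔR_cm k j
      simpa only [mul_inv_rev, inv_inv] using this
    refine ⟨fun k j => ?_, hRinv⟩
    have e : ∀ r, (H (-ϑ - 1) c r)⁻¹ = (H (-ϑ) c r)⁻¹ * (H (-ϑ) c r * (H (-ϑ - 1) c r)⁻¹) := by
      intro r
      have h0 := (hP0 r).ne'
      field_simp
    have hsum : (∑ i ∈ range (k + 1), (-1 : ℝ) ^ i * (k.choose i : ℝ) * (H (-ϑ - 1) c (j + i))⁻¹) =
        ∑ i ∈ range (k + 1), (-1 : ℝ) ^ i * (k.choose i : ℝ) *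
          ((H (-ϑ) c (j + i))⁻¹ * (H (-ϑ) c (j + i) * (H (-ϑ - 1) c (j + i))⁻¹)) :=
      sum_congr rfl fun i _ => by rw [← e (j + i)]
    rw [hsum]
    exact altSum_mul_nonneg (fun r => (H (-ϑ) c r)⁻¹) (fun r => H (-ϑ) c r * (H (-ϑ - 1) c r)⁻¹)
      ihA hRinv k j

/-- **THEOREM A′ (Region I).**  Let `θ = θ₀ + n` with `0 < θ₀ ≤ 1`, `n ∈ ℕ`, let `γ > 0` with `1 - θ₀ ≤ γ`, and
`0 ≤ g < 1`.  Then the W♯ odds `a_m = m P(m-1)/(γ Q_θ(m))` of the pure-grabber `c̃ = γ Q_θ/P(·-1)`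
(`P = ₂F₁(-θ,-·;γ+1;g)`, `Q_θ = ₂F₁(-θ,-·;γ;g)`) have completely monotone first difference:
`Σ_{i≤k} (-1)^i C(k,i) (a_{j+i+1} - a_{j+i}) ≥ 0` for all `k, j`. -/
theorem pureGrabber_oddsDiff_altSum_nonneg (hg0 : 0 ≤ g) (hg1 : g < 1) (θ₀ : ℝ) (h0 : 0 < θ₀) (h1 : θ₀ ≤ 1)
    (n : ℕ) (γ : ℝ) (hγ : 0 < γ) (hγ1 : 1 - θ₀ ≤ γ) (k j : ℕ) :
    0 ≤ ∑ i ∈ range (k + 1), (-1 : ℝ) ^ i * (k.choose i : ℝ) *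
      ((((j + i + 1 : ℕ) : ℝ)) * H (-(θ₀ + n)) (γ + 1) (j + i + 1 - 1) / (γ * H (-(θ₀ + n)) γ (j + i + 1)) -
        (((j + i : ℕ) : ℝ)) * H (-(θ₀ + n)) (γ + 1) (j + i - 1) / (γ * H (-(θ₀ + n)) γ (j + i))) := by
  have hθ : 0 ≤ θ₀ + n := by positivity
  have hQ : ∀ m, 0 < H (-(θ₀ + n)) γ m := fun m => hyp_pos g H hH hg0 hg1 (-(θ₀ + n)) m γ hγ (by linarith)
  refine oddsDiff_altSum_nonneg_of_ratio g H hH hg0 hg1 (θ₀ + n) γ hθ hγ hQ (fun k' j' => ?_) k j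
  have := (hyp_inv_altSum_aux' g H hH hg0 hg1 γ hγ θ₀ h0 h1 hγ1 n).2 k' j'
  simpa only [div_eq_mul_inv] using this

end

/-- **THEOREM N TP_∞ for every `q_A`, matrix form (memo §2).**  Let `θ = θ₀ + n` (`0 < θ₀ ≤ 1`, `n ∈ ℕ`),
`γ > 0` with `γ ≥ 1 - θ₀` (e.g. `γ = s+1 ≥ 1`, or `θ ∈ ℕ`), `0 ≤ g < 1`, and let
`c̃_n := γ · ₂F₁(-θ,-n;γ;g) / ₂F₁(-θ,-(n-1);γ+1;g)` be the pure-grabber sequence of PROOF-THEOREM-H-g36 §6′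
(written with the finite Gauss sums).  Then for EVERY `λ > 0` the kernel `[(l + λ c̃_n)/(n-l)!]_{l ≤ n}` is totally
nonnegative.  With `λ = 1/g_A` this is THEOREM W♯'s criterion for the smoothed `x`-Laplace kernel of `F_s`,
`Ψ = (1+p_A u+q_A v)(1+p_B u+q_B v)^θ` (`γ = s+1`, `g = g_B`), so `F_s` is TP_∞ with no condition on `q_A`. -/
theorem lPlusC_div_factorial_tn_pureGrabber (θ₀ : ℝ) (n : ℕ) (γ g : ℝ) (h0 : 0 < θ₀) (h1 : θ₀ ≤ 1)
    (hγ : 0 < γ) (hγ1 : 1 - θ₀ ≤ γ) (hg0 : 0 ≤ g) (hg1 : g < 1) (lam : ℝ) (hlam : 0 < lam)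
    {k : ℕ} (r c' : Fin k → ℕ) (hr : StrictMono r) (hc' : StrictMono c') :
    0 ≤ (Matrix.of fun i j =>
      if c' j ≤ r i then ((c' j : ℝ) + lam *
        (γ * (∑ l ∈ range (r i + 1), ((r i).choose l : ℝ) * (-g) ^ l *
            ((∏ m ∈ range l, (-(θ₀ + n) + m)) / (∏ m ∈ range l, (γ + m)))) /
          (∑ l ∈ range (r i - 1 + 1), ((r i - 1).choose l : ℝ) * (-g) ^ l *
            ((∏ m ∈ range l, (-(θ₀ + n) + m)) / (∏ m ∈ range l, (γ + 1 + m)))))) /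
        ((r i - c' j)! : ℕ) else 0).det := by
  set P : ℝ → ℝ → ℕ → ℝ := fun a c r => ∑ l ∈ range (r + 1), (r.choose l : ℝ) * (-g) ^ l *
    ((∏ m ∈ range l, (a + m)) / (∏ m ∈ range l, (c + m))) with hPdef
  have hP : ∀ a c r, P a c r = ∑ l ∈ range (r + 1), (r.choose l : ℝ) * (-g) ^ l *
    ((∏ m ∈ range l, (a + m)) / (∏ m ∈ range l, (c + m))) := fun _ _ _ => rfl
  have hQpos : ∀ m, 0 < P (-(θ₀ + n)) γ m :=
    fun m => hyp_pos g P hP hg0 hg1 (-(θ₀ + n)) m γ hγ (by have : (0:ℝ) ≤ n := n.cast_nonneg; linarith)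
  have hPpos : ∀ m, 0 < P (-(θ₀ + n)) (γ + 1) m :=
    fun m => hyp_pos g P hP hg0 hg1 (-(θ₀ + n)) m (γ + 1) (by linarith)
      (by have : (0:ℝ) ≤ n := n.cast_nonneg; linarith)
  have := lPlusC_div_factorial_tn_of_odds
    (fun m => γ * P (-(θ₀ + n)) γ m / P (-(θ₀ + n)) (γ + 1) (m - 1))
    (fun m => div_pos (mul_pos hγ (hQpos m)) (hPpos (m - 1))) (fun k j => ?_) lam hlam r c' hr hc'
  · simpa only [hPdef] using this
  · have e : ∀ m : ℕ, ((m : ℕ) : ℝ) / (γ * P (-(θ₀ + n)) γ m / P (-(θ₀ + n)) (γ + 1) (m - 1)) =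
        ((m : ℕ) : ℝ) * P (-(θ₀ + n)) (γ + 1) (m - 1) / (γ * P (-(θ₀ + n)) γ m) := by
      intro m
      have h1 := (hQpos m).ne'
      have h2 := (hPpos (m - 1)).ne'
      have h3 := hγ.ne'
      field_simp
    simp_rw [e]
    have := pureGrabber_oddsDiff_altSum_nonneg g P hP hg0 hg1 θ₀ h0 h1 n γ hγ hγ1 k (j + 1)
    refine le_of_le_of_eq this (sum_congr rfl fun i _ => ?_)
    rw [show j + 1 + i = j + i + 1 by ring]

/-- **THEOREM N TP_∞ for every `q_A` — all real `θ > 0` when `γ ≥ 1` (i.e. every Ewens level `s ≥ 0`).**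
Same statement as `lPlusC_div_factorial_tn_pureGrabber` with `θ > 0` arbitrary and `γ ≥ 1`. -/
theorem lPlusC_div_factorial_tn_pureGrabber' (θ γ g : ℝ) (hθ : 0 < θ) (hγ : 1 ≤ γ) (hg0 : 0 ≤ g) (hg1 : g < 1)
    (lam : ℝ) (hlam : 0 < lam) {k : ℕ} (r c' : Fin k → ℕ) (hr : StrictMono r) (hc' : StrictMono c') :
    0 ≤ (Matrix.of fun i j =>
      if c' j ≤ r i then ((c' j : ℝ) + lam *
        (γ * (∑ l ∈ range (r i + 1), ((r i).choose l : ℝ) * (-g) ^ l *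
            ((∏ m ∈ range l, (-θ + m)) / (∏ m ∈ range l, (γ + m)))) /
          (∑ l ∈ range (r i - 1 + 1), ((r i - 1).choose l : ℝ) * (-g) ^ l *
            ((∏ m ∈ range l, (-θ + m)) / (∏ m ∈ range l, (γ + 1 + m)))))) /
        ((r i - c' j)! : ℕ) else 0).det := by
  have hceil : 1 ≤ ⌈θ⌉₊ := Nat.one_le_iff_ne_zero.2 (Nat.pos_iff_ne_zero.1 (Nat.ceil_pos.2 hθ))
  obtain ⟨n, hn1, hn2⟩ : ∃ n : ℕ, (n : ℝ) < θ ∧ θ ≤ n + 1 := by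
    refine ⟨⌈θ⌉₊ - 1, ?_, ?_⟩
    · have h1 := Nat.ceil_lt_add_one hθ.le
      rw [Nat.cast_sub hceil, Nat.cast_one]
      linarith
    · have h2 := Nat.le_ceil θ
      rw [Nat.cast_sub hceil, Nat.cast_one]
      linarith
  have := lPlusC_div_factorial_tn_pureGrabber (θ - n) n γ g (by linarith) (by linarith) (by linarith)
    (by linarith) hg0 hg1 lam hlam r c' hr hc'
  simpa only [sub_add_cancel] using this

end HypergeomCM

end Summit.CriticalPhenomena.PercolationContinuityZ3.Theorems
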